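import Summits.ResolutionOfSingularities.ResolutionOfSingularities.Theorems.RadicialJungCleanModelsLocalMonomializationOfEmbRes
import Literature.AlgebraicGeometry.Resolution.LocalBlowupModels
import HarnessLib

/-!
# Local monomialization along a PROPER COARSENING, realised inside the finer valuation ring (Novacoski–Spivakovsky's Cor. 2.14 device)

Route `RadicialJung`, crux `CleanModels` (stmt-ResolutionOfSingularities-15917), registered skeleton `Cruxes/CleanModels/Lines/Sketch.lean`
rev 35 (sha16 de44649d8f729c3b), stub 7 `stub_cleanModelsDimGEFour`.  Explicit-unit seat `decomp-res-hand-2` g4 (structural hand); memo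
`Cruxes/CleanModels/Lines/Sketch-memo-hand2-g4-stubs-5-7.md` §2 / §5 items 1–2.  OURS; structural bookkeeping toward the rank-one reduction of
the local input `hMono_4`; counted 0; nothing here proves resolution of singularities in characteristic `p`.

For a composite valuation `ν = ν₁ ∘ ν₂` (`O ≤ O₁`), Novacoski–Spivakovsky (arXiv:1204.4751, Lemma 2.12 / Cor. 2.13 / Cor. 2.14) realise any
finitely generated `ν₁`-model `A₁ ⊆ O₁` above `A ⊆ O` by a finitely generated model `A₂ ⊆ O` with THE SAME local ring at the centre of
`ν₁`: replace each generator `f ∉ O` by `f⁻¹ ∈ 𝔪_O` (such an `f` is a `ν₁`-unit).  The tree's ✓ `novacoskiSpivakovsky2014_cor214`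
(`Literature/…/RankOneReductionProofs.lean`) records the REGULARITY consequence; here the equality of local rings is recorded in the
`locAtCentre` currency of the `CleanModels` files, so that MONOMIAL DATA (weak embedded local uniformization, NS Def. 2.21) transport too:

* `locAtCentre_eq_of_mutual_le` — two subrings each contained in the other's local ring at the centre of `O'` have the same local ring there;
* `exists_model_le_of_model_le_coarsening` — the Cor. 2.14 device with `locAtCentre A₂ O₁ = locAtCentre A₁ O₁`;
* `localMonomialization_along_coarsening_of_embeddedResolution` — **weak embedded LU along a coarsening `O₁ ≥ O` whose centre on the model
  has local dimension `n + 1 ≤ 3`, realised INSIDE `O`**, modulo F-32 in its CJS Cor. 1.5 shape `hEmb` (hand-2 g3's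
  ✓ `localMonomialization_of_embeddedResolution`, which has no zero-dimensionality hypothesis, applied along `O₁`, then the device).
  This is step (i) of NS §3.2 for `hMono_4` in the sub-case «centre of `ν₁` ≠ closed point» (memo §2): PRINT.
[cite: NovacoskiSpivakovsky2014, Lemma 2.5 (1), Lemma 2.12, Cor. 2.13, Cor. 2.14] [cite: CossartJannsenSaito2020, Cor. 1.5]
-/

noncomputable section

set_option linter.dupNamespace false -- mandated namespace of this single-conjunct summit

open IsLocalRing AlgebraicGeometry CategoryTheory
open Literature.AlgebraicGeometry.Resolution Literature.AlgebraicGeometry.Motives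

namespace Summit.ResolutionOfSingularities.ResolutionOfSingularities.Theorems.RadicialJung.CleanModels



variable {k K : Type} [Field k] [Field K] [Algebra k K]

/-- **Mutual domination gives the same local ring at the centre** (Novacoski–Spivakovsky 2014, Lemma 2.5 (1) twice + idempotence):
if `B ⊆ C_{𝔪_{O'} ∩ C}` and `C ⊆ B_{𝔪_{O'} ∩ B}` inside `K`, then `B_{𝔪_{O'} ∩ B} = C_{𝔪_{O'} ∩ C}`.
[cite: NovacoskiSpivakovsky2014, Lemma 2.5 (1)] -/
theorem locAtCentre_eq_of_mutual_le (O' : ValuationSubring K) (B C : Subring K)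
    (hBC : B ≤ locAtCentre C O') (hCB : C ≤ locAtCentre B O') :
    locAtCentre B O' = locAtCentre C O' := by
  refine le_antisymm ?_ ?_
  · calc locAtCentre B O' ≤ locAtCentre (locAtCentre C O') O' := locAtCentre_mono O' hBC
      _ = locAtCentre C O' := locAtCentre_locAtCentre C O'
  · calc locAtCentre C O' ≤ locAtCentre (locAtCentre B O') O' := locAtCentre_mono O' hCB
      _ = locAtCentre B O' := locAtCentre_locAtCentre B O'

/-- An element of `O₁ ∖ O` (`O ≤ O₁`) is a unit of `O₁`: its inverse lies in `𝔪_O ⊆ O ≤ O₁`, so `ν₁(f) = 1`. [folklore] -/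
theorem valuation_eq_one_of_mem_of_not_mem (O O₁ : ValuationSubring K) (hOO₁ : O ≤ O₁) {f : K}
    (hf₁ : f ∈ O₁) (hfO : f ∉ O) : O₁.valuation f = 1 := by
  have hfinvO : f⁻¹ ∈ O := (O.mem_or_inv_mem f).resolve_left hfO
  have hfinv₁ : f⁻¹ ∈ O₁ := hOO₁ hfinvO
  have hf0 : f ≠ 0 := by rintro rfl; exact hfO O.zero_mem
  have h1 : O₁.valuation f ≤ 1 := (O₁.valuation_le_one_iff f).mpr hf₁
  have h2 : O₁.valuation f⁻¹ ≤ 1 := (O₁.valuation_le_one_iff _).mpr hfinv₁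
  rw [map_inv₀, inv_le_one₀ (by rwa [Valuation.pos_iff])] at h2
  exact le_antisymm h1 h2

/-- **The Cor. 2.14 device (Novacoski–Spivakovsky 2014), `locAtCentre` form.**  For `O ≤ O₁`, a finitely generated `A ⊆ O` and a finitely
generated `A ≤ A₁ ⊆ O₁`, there is a finitely generated `A ≤ A₂ ⊆ O` with `locAtCentre A₂ O₁ = locAtCentre A₁ O₁`: take
`A₂ = A[g_1, …, g_m]` for generators `f_i` of `A₁`, `g_i = f_i` if `f_i ∈ O` and `g_i = f_i⁻¹` otherwise (then `f_i` is a `ν₁`-unit, so each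
of `A₁`, `A₂` lies in the other's local ring at the centre of `ν₁`). [cite: NovacoskiSpivakovsky2014, Lemma 2.12, Cor. 2.13, Cor. 2.14] -/
theorem exists_model_le_of_model_le_coarsening (O O₁ : ValuationSubring K) (hOO₁ : O ≤ O₁)
    (A : Subalgebra k K) (hAO : A.toSubring ≤ O.toSubring) (hAfg : A.FG)
    (A₁ : Subalgebra k K) (hA₁O₁ : A₁.toSubring ≤ O₁.toSubring) (hAA₁ : A ≤ A₁) (hA₁fg : A₁.FG) :
    ∃ (A₂ : Subalgebra k K), A₂.toSubring ≤ O.toSubring ∧ A ≤ A₂ ∧ A₂.FG ∧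
      locAtCentre A₂.toSubring O₁ = locAtCentre A₁.toSubring O₁ := by
  classical
  obtain ⟨t, ht⟩ := hA₁fg
  -- the modified generators
  let g : K → K := fun f => if f ∈ O then f else f⁻¹
  have hgO : ∀ f, g f ∈ O := by
    intro f
    by_cases hf : f ∈ O
    · simp only [g, hf, if_true]
    · simp only [g, hf, if_false]; exact (O.mem_or_inv_mem f).resolve_left hf
  have htA₁ : ∀ f ∈ t, f ∈ A₁ := fun f hf => ht ▸ Algebra.subset_adjoin hf
  let A₂ : Subalgebra k K := Algebra.adjoin k ((A : Set K) ∪ ↑(t.image g))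
  have hAA₂ : A ≤ A₂ := fun x hx => Algebra.subset_adjoin (Or.inl hx)
  have hk : ∀ c : k, algebraMap k K c ∈ O := fun c => hAO (A.algebraMap_mem c)
  -- `A₂ ⊆ O`
  let Ok : Subalgebra k K := ({ O.toSubring with algebraMap_mem' := hk } : Subalgebra k K)
  have hA₂Ok : A₂ ≤ Ok := by
    refine Algebra.adjoin_le ?_
    rintro y (hy | hy)
    · exact hAO hy
    · obtain ⟨f, -, rfl⟩ := Finset.mem_image.mp (Finset.mem_coe.mp hy)
      exact hgO f
  have hA₂O : A₂.toSubring ≤ O.toSubring := fun x hx => hA₂Ok hx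
  refine ⟨A₂, hA₂O, hAA₂, fg_adjoin_subalgebra_union A hAfg (t.image g), ?_⟩
  -- the two local rings at the centre of `ν₁`, as `k`-subalgebras
  let L₁ : Subalgebra k K :=
    ({ locAtCentre A₁.toSubring O₁ with
        algebraMap_mem' := fun c => le_locAtCentre A₁.toSubring O₁ (A₁.algebraMap_mem c) } : Subalgebra k K)
  let L₂ : Subalgebra k K :=
    ({ locAtCentre A₂.toSubring O₁ with
        algebraMap_mem' := fun c => le_locAtCentre A₂.toSubring O₁ (A₂.algebraMap_mem c) } : Subalgebra k K)
  -- `A₂ ⊆ (A₁)_{centre of ν₁}`: `A ⊆ A₁`, and `g f = f ∈ A₁` or `g f = f⁻¹` with `f` a `ν₁`-unit of `A₁`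
  have h21 : A₂ ≤ L₁ := by
    refine Algebra.adjoin_le ?_
    rintro y (hy | hy)
    · exact le_locAtCentre A₁.toSubring O₁ (hAA₁ hy)
    · obtain ⟨f, hf, rfl⟩ := Finset.mem_image.mp (Finset.mem_coe.mp hy)
      by_cases hfO : f ∈ O
      · have hgf : g f = f := by simp only [g, hfO, if_true]
        rw [hgf]
        exact le_locAtCentre A₁.toSubring O₁ (htA₁ f hf)
      · have hgf : g f = f⁻¹ := by simp only [g, hfO, if_false]
        rw [hgf]
        exact inv_mem_locAtCentre (le_locAtCentre A₁.toSubring O₁ (htA₁ f hf))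
          (valuation_eq_one_of_mem_of_not_mem O O₁ hOO₁ (hA₁O₁ (htA₁ f hf)) hfO)
  -- `A₁ ⊆ (A₂)_{centre of ν₁}`: a generator `f ∈ t` is `g f ∈ A₂`, or the inverse of the `ν₁`-unit `g f = f⁻¹ ∈ A₂`
  have h12 : A₁ ≤ L₂ := by
    rw [← ht]
    refine Algebra.adjoin_le ?_
    intro y hy
    have hyt : y ∈ t := Finset.mem_coe.mp hy
    have hgy : g y ∈ A₂ := Algebra.subset_adjoin (Or.inr (Finset.mem_coe.mpr (Finset.mem_image_of_mem g hyt)))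
    by_cases hyO : y ∈ O
    · have hgy' : g y = y := by simp only [g, hyO, if_true]
      rw [hgy'] at hgy
      exact le_locAtCentre A₂.toSubring O₁ hgy
    · have hgy' : g y = y⁻¹ := by simp only [g, hyO, if_false]
      rw [hgy'] at hgy
      have hy₁ : O₁.valuation y = 1 :=
        valuation_eq_one_of_mem_of_not_mem O O₁ hOO₁ (hA₁O₁ (htA₁ y hyt)) hyO
      have hinv : O₁.valuation y⁻¹ = 1 := by rw [map_inv₀, hy₁, inv_one]
      have h := inv_mem_locAtCentre (le_locAtCentre A₂.toSubring O₁ hgy) hinv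
      rwa [inv_inv] at h
  exact locAtCentre_eq_of_mutual_le O₁ A₂.toSubring A₁.toSubring (fun x hx => h21 hx) (fun x hx => h12 hx)

/-- **Weak embedded local uniformization ALONG A COARSENING whose centre has local dimension `≤ 3`, realised INSIDE the finer valuation
ring — modulo F-32.**  For `O ≤ O₁`, a finitely generated `A ⊆ O` whose local ring at the centre of `O₁` is regular of dimension
`n + 1 ≤ 3`, and a finite `Z ⊆ A`: there is a finitely generated `A ≤ A₂ ⊆ O` whose local ring at the centre of `O₁` is regular, with a
regular system of parameters in which every non-zero `z ∈ Z` is a unit times a monomial.  Proof: hand-2 g3's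
✓ `localMonomialization_of_embeddedResolution` along `O₁` (no zero-dimensionality needed), then `exists_model_le_of_model_le_coarsening`.
In the rank-one reduction of `hMono_4` (Novacoski–Spivakovsky 2012 §3.2, step (i), sub-case «the centre of `ν₁` on the regular 4-dimensional
model is not the closed point», so its local dimension is `≤ 3`) this is the whole of step (i): PRINT.
[cite: NovacoskiSpivakovsky2014, Cor. 2.14 and §3.2] [cite: CossartJannsenSaito2020, Cor. 1.5] -/
theorem localMonomialization_along_coarsening_of_embeddedResolution
    (hEmb : ∀ (Z : Scheme.{0}) [IsIntegral Z] [IsNoetherian Z], Scheme.IsRegular Z →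
      Scheme.IsExcellent Z → ∀ (X : Set Z), IsClosed X → X ≠ Set.univ → topologicalKrullDim X ≤ 2 →
        ∃ (Z' : Scheme.{0}) (π : Z' ⟶ Z), IsProper π ∧ Function.Surjective π.base ∧
          (∃ U : Z.Opens, (U : Set Z) = Xᶜ ∧ IsIso (π ∣_ U)) ∧
          IsStrictNormalCrossingsDivisor Z' (π.base ⁻¹' X))
    {n : ℕ} (hn : n ≤ 2)
    (O O₁ : ValuationSubring K) (hOO₁ : O ≤ O₁)
    (A : Subalgebra k K) (hAO : A.toSubring ≤ O.toSubring) (hAfg : A.FG)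
    (hreg : IsRegularLocalRing (locAtCentre A.toSubring O₁))
    (hdim : ringKrullDim (locAtCentre A.toSubring O₁) = (n + 1 : ℕ))
    (Z : Finset K) (hZ : ∀ z ∈ Z, z ∈ A) :
    ∃ (A₂ : Subalgebra k K), A₂.toSubring ≤ O.toSubring ∧ A ≤ A₂ ∧ A₂.FG ∧
    ∃ (_ : IsRegularLocalRing (locAtCentre A₂.toSubring O₁)) (e : ℕ) (a : Fin e → ↥(locAtCentre A₂.toSubring O₁)),
      Ideal.span (Set.range a) = IsLocalRing.maximalIdeal ↥(locAtCentre A₂.toSubring O₁) ∧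
      ringKrullDim ↥(locAtCentre A₂.toSubring O₁) = (e : WithBot ℕ∞) ∧
      ∀ z ∈ Z, z ≠ 0 → ∃ (v : ↥(locAtCentre A₂.toSubring O₁)) (μ : Fin e → ℕ), IsUnit v ∧
        z = (v : K) * ∏ i, ((a i : ↥(locAtCentre A₂.toSubring O₁)) : K) ^ (μ i) := by
  -- monomialize along `O₁`
  obtain ⟨A₁, hA₁O₁, hAA₁, hA₁fg, hreg₁, e, a, ha, hdim₁, hmono⟩ :=
    localMonomialization_of_embeddedResolution 2 hEmb hn k K O₁ A (hAO.trans hOO₁) hAfg hreg hdim Z hZ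
  -- realise the model inside `O` with the same local ring at the centre of `ν₁`
  obtain ⟨A₂, hA₂O, hAA₂, hA₂fg, heq⟩ :=
    exists_model_le_of_model_le_coarsening O O₁ hOO₁ A hAO hAfg A₁ hA₁O₁ hAA₁ hA₁fg
  refine ⟨A₂, hA₂O, hAA₂, hA₂fg, ?_⟩
  rw [heq]
  exact ⟨hreg₁, e, a, ha, hdim₁, hmono⟩

end Summit.ResolutionOfSingularities.ResolutionOfSingularities.Theorems.RadicialJung.CleanModels

end
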